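import Summits.QuantumFields.YangMills.Theorems.BalabanLadderIRAfOnsetRiemannSums

/-!
# Crux `IR` (stmt-QuantumFields-19354), line `af-pincer`, stub `stub_afOnsetUc : AFToOnsetUKPc` (X-side):
# time-slice geometry of `ℤ⁴` and the transverse-then-time sums at positive times

Second file of the chain `…AfOnsetRiemannSums → …AfOnsetSliceSums → …AfOnsetDoubleSums / …AfOnsetTails → IR/AfPincerUcXCov`
(seat ym-19354-afpincer-s2, generation 2).  For lattice points `x` at negative times (`x 0 ≤ −1`, `a = −x 0`) and
`y` at positive times (`1 ≤ y 0`, `b = y 0`) the envelope kernel splits as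
`(1+‖x−y‖)⁻⁸ ≤ 64 (a+b)⁻² (1 + a + b + ‖x' − y'‖)⁻⁶` (`inv_pow_eight_le`; `x' = Fin.tail x` the transverse part) and a
function with the cubic bound `|F u| ≤ C |u 0|³ (1+‖u‖)⁻¹⁰` (file `…AfOnsetHalfSpace`: `v` and `θv` for
`tsupport v ⊆ {y | 0 < y 0}`) obeys the row form `|F(s x)| ≤ C (s a)³(1+s a)⁻³ (1+s‖x'‖)⁻⁷` (`abs_apply_smul_le_row`).
Main estimates: **`inner_sum_eight_le`** `Σ_{y : 1 ≤ y 0} (s b)³(1+s b)⁻³ / ((a+b)² (1+a+b+‖c−y'‖)⁶) ≤ Z₃ s² / a²` and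
**`inner_sum_seven_le`** (one power of `a+b` less: `≤ Z₃ s / a²`), `Z₃ = 27 Σ(k+1)⁻²` — fibre the sum by the time
coordinate, inject each fibre into `ℤ³` by `Fin.tail`, use the shifted transverse Riemann sum and the telescoping sums.

HONEST FRAMING.  Elementary real analysis (folklore); nothing about Yang–Mills is asserted; one open stub of one open
gap-crux of a CONDITIONAL chain (Track A 0/28 UV); not a gap claim.
-/

set_option autoImplicit false

noncomputable section

open Filter Topology Finset
open scoped BigOperators
open Literature.MathematicalPhysics.QuantumLattice
open Literature.Probability.LatticeModels (Site box mem_box)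
open Summit.QuantumFields.YangMills.Theorems.OSLegsFromFemtoAndGap (summable_inv_succ_sq mul_norm_le_norm_smul_siteToE)

namespace Summit.QuantumFields.YangMills.Cruxes.IR.AfOnset

/-! ## §3 Time slices of `ℤ⁴`, kernel splits and pointwise bounds -/
section Slices

/-- Abbreviation-free Riemann constant in dimension 3: `Z₃ = 27 Σ (k+1)⁻²`. [folklore] -/
theorem riemann_const_three_eq : (3 : ℝ) ^ 3 * ∑' k : ℕ, (((k : ℝ) + 1) ^ 2)⁻¹ = 27 * ∑' k : ℕ, (((k : ℝ) + 1) ^ 2)⁻¹ := by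
  norm_num

/-- A vector of `ℤ⁴` is its time coordinate consed onto its transverse part; so sites with equal time coordinates and
equal transverse parts are equal. [folklore] -/
theorem eq_of_apply_zero_eq_of_tail_eq {y₁ y₂ : Site 4} (h0 : y₁ 0 = y₂ 0) (ht : Fin.tail y₁ = Fin.tail y₂) : y₁ = y₂ := by
  rw [← Fin.cons_self_tail y₁, ← Fin.cons_self_tail y₂, h0, ht]

/-- The transverse part is `1`-Lipschitz for the sup norms: `‖tail x‖ ≤ ‖x‖`. [folklore] -/
theorem norm_tail_le (x : Site 4) : ‖Fin.tail x‖ ≤ ‖x‖ :=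
  (pi_norm_le_iff_of_nonneg (norm_nonneg _)).2 fun i => norm_le_pi_norm x i.succ

/-- The time separation is at most the sup distance: `y 0 − x 0 ≤ ‖x − y‖` (as reals). [folklore] -/
theorem sub_apply_zero_le_norm_sub (x y : Site 4) : ((y 0 : ℝ) - (x 0 : ℝ)) ≤ ‖x - y‖ := by
  have h1 : ‖(x - y) 0‖ ≤ ‖x - y‖ := norm_le_pi_norm (x - y) 0
  rw [Pi.sub_apply, Int.norm_eq_abs] at h1
  push_cast at h1
  linarith [neg_abs_le ((x 0 : ℝ) - (y 0 : ℝ))]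

/-- **Kernel split, exponent 8.**  For `x 0 ≤ −1 < 1 ≤ y 0`, with `m = y 0 − x 0`:
`(1+‖x−y‖)⁻⁸ ≤ 64 / (m² (1 + m + ‖x' − y'‖)⁶)`. [folklore] -/
theorem inv_pow_eight_le (x y : Site 4) (hx : x 0 ≤ -1) (hy : 1 ≤ y 0) :
    ((1 + ‖x - y‖) ^ 8)⁻¹ ≤
      64 / ((-(x 0 : ℝ) + (y 0 : ℝ)) ^ 2 * (1 + (-(x 0 : ℝ) + (y 0 : ℝ)) + ‖Fin.tail x - Fin.tail y‖) ^ 6) := by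
  rw [neg_add_eq_sub]
  have hm0 : (0 : ℝ) < (y 0 : ℝ) - (x 0 : ℝ) := by
    have h1 : ((x 0 : ℤ) : ℝ) ≤ -1 := by exact_mod_cast hx
    have h2 : (1 : ℝ) ≤ ((y 0 : ℤ) : ℝ) := by exact_mod_cast hy
    linarith
  have hm : (y 0 : ℝ) - (x 0 : ℝ) ≤ ‖x - y‖ := sub_apply_zero_le_norm_sub x y
  have ht : ‖Fin.tail x - Fin.tail y‖ ≤ ‖x - y‖ := norm_tail_le (x - y)
  have hpos : 0 < ((y 0 : ℝ) - (x 0 : ℝ)) ^ 2 * (1 + ((y 0 : ℝ) - (x 0 : ℝ)) + ‖Fin.tail x - Fin.tail y‖) ^ 6 := by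
    positivity
  rw [inv_eq_one_div, div_le_div_iff₀ (by positivity) hpos, one_mul]
  have h1 : ((y 0 : ℝ) - (x 0 : ℝ)) ^ 2 ≤ (1 + ‖x - y‖) ^ 2 :=
    pow_le_pow_left₀ hm0.le (by linarith) 2
  have h2 : (1 + ((y 0 : ℝ) - (x 0 : ℝ)) + ‖Fin.tail x - Fin.tail y‖) ^ 6 ≤ (2 * (1 + ‖x - y‖)) ^ 6 :=
    pow_le_pow_left₀ (by positivity) (by linarith) 6
  calc ((y 0 : ℝ) - (x 0 : ℝ)) ^ 2 * (1 + ((y 0 : ℝ) - (x 0 : ℝ)) + ‖Fin.tail x - Fin.tail y‖) ^ 6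
      ≤ (1 + ‖x - y‖) ^ 2 * (2 * (1 + ‖x - y‖)) ^ 6 := mul_le_mul h1 h2 (by positivity) (by positivity)
    _ = 64 * (1 + ‖x - y‖) ^ 8 := by ring

/-- **Kernel split, exponent 7**: `(1+‖x−y‖)⁻⁷ ≤ 64 / (m (1 + m + ‖x' − y'‖)⁶)`. [folklore] -/
theorem inv_pow_seven_le (x y : Site 4) (hx : x 0 ≤ -1) (hy : 1 ≤ y 0) :
    ((1 + ‖x - y‖) ^ 7)⁻¹ ≤
      64 / ((-(x 0 : ℝ) + (y 0 : ℝ)) * (1 + (-(x 0 : ℝ) + (y 0 : ℝ)) + ‖Fin.tail x - Fin.tail y‖) ^ 6) := by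
  rw [neg_add_eq_sub]
  have hm0 : (0 : ℝ) < (y 0 : ℝ) - (x 0 : ℝ) := by
    have h1 : ((x 0 : ℤ) : ℝ) ≤ -1 := by exact_mod_cast hx
    have h2 : (1 : ℝ) ≤ ((y 0 : ℤ) : ℝ) := by exact_mod_cast hy
    linarith
  have hm : (y 0 : ℝ) - (x 0 : ℝ) ≤ ‖x - y‖ := sub_apply_zero_le_norm_sub x y
  have ht : ‖Fin.tail x - Fin.tail y‖ ≤ ‖x - y‖ := norm_tail_le (x - y)
  have hpos : 0 < ((y 0 : ℝ) - (x 0 : ℝ)) * (1 + ((y 0 : ℝ) - (x 0 : ℝ)) + ‖Fin.tail x - Fin.tail y‖) ^ 6 := by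
    positivity
  rw [inv_eq_one_div, div_le_div_iff₀ (by positivity) hpos, one_mul]
  have h1 : ((y 0 : ℝ) - (x 0 : ℝ)) ≤ (1 + ‖x - y‖) := by linarith
  have h2 : (1 + ((y 0 : ℝ) - (x 0 : ℝ)) + ‖Fin.tail x - Fin.tail y‖) ^ 6 ≤ (2 * (1 + ‖x - y‖)) ^ 6 :=
    pow_le_pow_left₀ (by positivity) (by linarith) 6
  calc ((y 0 : ℝ) - (x 0 : ℝ)) * (1 + ((y 0 : ℝ) - (x 0 : ℝ)) + ‖Fin.tail x - Fin.tail y‖) ^ 6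
      ≤ (1 + ‖x - y‖) * (2 * (1 + ‖x - y‖)) ^ 6 := mul_le_mul h1 h2 (by positivity) (by positivity)
    _ = 64 * (1 + ‖x - y‖) ^ 7 := by ring

variable {F G : EuclideanSpace ℝ (Fin 4) → ℝ} {C : ℝ}

/-- **Row form of the cubic bound at negative-time lattice points**: for `x 0 ≤ −1`, `a = −x 0`,
`|F(s x)| ≤ C (s a)³ (1 + s a)⁻³ (1 + s‖x'‖)⁻⁷`. [folklore] -/
theorem abs_apply_smul_le_row (hC : 0 ≤ C)
    (hF : ∀ u : EuclideanSpace ℝ (Fin 4), |F u| ≤ C * |u 0| ^ 3 / (1 + ‖u‖) ^ 10)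
    {s : ℝ} (hs : 0 < s) (x : Site 4) (hx : x 0 ≤ -1) :
    |F (s • siteToE x)| ≤
      C * ((s * (-(x 0 : ℝ))) ^ 3 / (1 + s * (-(x 0 : ℝ))) ^ 3) * ((1 + s * ‖Fin.tail x‖) ^ 7)⁻¹ := by
  set u : EuclideanSpace ℝ (Fin 4) := s • siteToE x with hu
  have ha : (1 : ℝ) ≤ -(x 0 : ℝ) := by
    have h1 : ((x 0 : ℤ) : ℝ) ≤ -1 := by exact_mod_cast hx
    linarith
  have hu0 : |u 0| = s * (-(x 0 : ℝ)) := by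
    rw [hu, show (s • siteToE x) 0 = s * (x 0 : ℝ) by simp [siteToE_apply], abs_mul, abs_of_pos hs,
      abs_of_nonpos (by linarith)]
  have h1 : s * (-(x 0 : ℝ)) ≤ ‖u‖ := by rw [← hu0]; simpa using PiLp.norm_apply_le u 0
  have h2 : s * ‖Fin.tail x‖ ≤ ‖u‖ :=
    (mul_le_mul_of_nonneg_left (norm_tail_le x) hs.le).trans (mul_norm_le_norm_smul_siteToE hs.le x)
  have hden : (1 + s * (-(x 0 : ℝ))) ^ 3 * (1 + s * ‖Fin.tail x‖) ^ 7 ≤ (1 + ‖u‖) ^ 10 := by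
    calc (1 + s * (-(x 0 : ℝ))) ^ 3 * (1 + s * ‖Fin.tail x‖) ^ 7 ≤ (1 + ‖u‖) ^ 3 * (1 + ‖u‖) ^ 7 :=
          mul_le_mul (pow_le_pow_left₀ (by positivity) (by linarith) 3)
            (pow_le_pow_left₀ (by positivity) (by linarith) 7) (by positivity) (by positivity)
      _ = (1 + ‖u‖) ^ 10 := by ring
  have hpos : 0 < (1 + s * (-(x 0 : ℝ))) ^ 3 * (1 + s * ‖Fin.tail x‖) ^ 7 := by positivity
  calc |F u| ≤ C * |u 0| ^ 3 / (1 + ‖u‖) ^ 10 := hF u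
    _ ≤ C * |u 0| ^ 3 / ((1 + s * (-(x 0 : ℝ))) ^ 3 * (1 + s * ‖Fin.tail x‖) ^ 7) :=
        div_le_div_of_nonneg_left (by positivity) hpos hden
    _ = C * ((s * (-(x 0 : ℝ))) ^ 3 / (1 + s * (-(x 0 : ℝ))) ^ 3) * ((1 + s * ‖Fin.tail x‖) ^ 7)⁻¹ := by
        rw [hu0]; field_simp

/-- **Cubic bound at positive-time lattice points**: for `1 ≤ y 0`, `b = y 0`, `|G(s y)| ≤ C (s b)³ (1 + s b)⁻³`.
[folklore] -/
theorem abs_apply_smul_le_col (hC : 0 ≤ C)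
    (hG : ∀ u : EuclideanSpace ℝ (Fin 4), |G u| ≤ C * |u 0| ^ 3 / (1 + ‖u‖) ^ 10)
    {s : ℝ} (hs : 0 < s) (y : Site 4) (hy : 1 ≤ y 0) :
    |G (s • siteToE y)| ≤ C * ((s * (y 0 : ℝ)) ^ 3 / (1 + s * (y 0 : ℝ)) ^ 3) := by
  set u : EuclideanSpace ℝ (Fin 4) := s • siteToE y with hu
  have hb : (1 : ℝ) ≤ (y 0 : ℝ) := by exact_mod_cast hy
  have hu0 : |u 0| = s * (y 0 : ℝ) := by
    rw [hu, show (s • siteToE y) 0 = s * (y 0 : ℝ) by simp [siteToE_apply], abs_mul, abs_of_pos hs,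
      abs_of_nonneg (by linarith)]
  have h1 : s * (y 0 : ℝ) ≤ ‖u‖ := by rw [← hu0]; simpa using PiLp.norm_apply_le u 0
  have hden : (1 + s * (y 0 : ℝ)) ^ 3 ≤ (1 + ‖u‖) ^ 10 := by
    calc (1 + s * (y 0 : ℝ)) ^ 3 ≤ (1 + ‖u‖) ^ 3 := pow_le_pow_left₀ (by positivity) (by linarith) 3
      _ ≤ (1 + ‖u‖) ^ 10 := pow_le_pow_right₀ (by linarith [norm_nonneg u]) (by norm_num)
  have hpos : 0 < (1 + s * (y 0 : ℝ)) ^ 3 := by positivity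
  calc |G u| ≤ C * |u 0| ^ 3 / (1 + ‖u‖) ^ 10 := hG u
    _ ≤ C * |u 0| ^ 3 / (1 + s * (y 0 : ℝ)) ^ 3 := div_le_div_of_nonneg_left (by positivity) hpos hden
    _ = C * ((s * (y 0 : ℝ)) ^ 3 / (1 + s * (y 0 : ℝ)) ^ 3) := by rw [hu0]; ring

/-- **Transverse-then-time sum at positive times, exponent 8** (`a ≥ 1`, `c ∈ ℤ³` fixed):
`Σ_{y : 1 ≤ y 0} (s b)³(1+s b)⁻³ / ((a+b)² (1+a+b+‖c−y'‖)⁶) ≤ Z₃ s² / a²`. [folklore] -/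
theorem inner_sum_eight_le {s : ℝ} (hs : 0 < s) {a : ℝ} (ha : 1 ≤ a) (c : Site 3) (Y : Finset (Site 4)) :
    ∑ y ∈ Y.filter (fun y => 1 ≤ y 0),
        (s * (y 0 : ℝ)) ^ 3 / (1 + s * (y 0 : ℝ)) ^ 3 /
          ((a + (y 0 : ℝ)) ^ 2 * (1 + (a + (y 0 : ℝ)) + ‖c - Fin.tail y‖) ^ 6) ≤
      (3 ^ 3 * ∑' k : ℕ, (((k : ℝ) + 1) ^ 2)⁻¹) * s ^ 2 / a ^ 2 := by
  classical
  set Z : ℝ := 3 ^ 3 * ∑' k : ℕ, (((k : ℝ) + 1) ^ 2)⁻¹ with hZ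
  have hZ0 : 0 ≤ Z := riemann_const_nonneg 3
  set Yf := Y.filter (fun y => 1 ≤ y 0) with hYf
  set g : Site 4 → ℕ := fun y => (y 0).toNat with hg
  have ha0 : 0 < a := lt_of_lt_of_le one_pos ha
  rw [← Finset.sum_fiberwise_of_maps_to (g := g) (t := Yf.image g) (fun y hy => Finset.mem_image_of_mem g hy)]
  -- each fibre `{y 0 = b}`
  have hfib : ∀ b ∈ Yf.image g,
      ∑ y ∈ Yf.filter (fun y => g y = b),
          (s * (y 0 : ℝ)) ^ 3 / (1 + s * (y 0 : ℝ)) ^ 3 /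
            ((a + (y 0 : ℝ)) ^ 2 * (1 + (a + (y 0 : ℝ)) + ‖c - Fin.tail y‖) ^ 6) ≤
        Z / a ^ 2 * (s ^ 3 / (1 + s * (b : ℝ)) ^ 3) := by
    intro b hb
    -- `b ≥ 1` and `y 0 = b` on the fibre
    have hb1 : 1 ≤ b := by
      obtain ⟨y, hy, rfl⟩ := Finset.mem_image.1 hb
      have hy1 : 1 ≤ y 0 := (Finset.mem_filter.1 hy).2
      have : (1 : ℤ) ≤ ((y 0).toNat : ℤ) := by rw [Int.toNat_of_nonneg (by omega)]; exact hy1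
      exact_mod_cast this
    have hyb : ∀ y ∈ Yf.filter (fun y => g y = b), (y 0 : ℝ) = (b : ℝ) := by
      intro y hy
      have hy' := Finset.mem_filter.1 hy
      have hy1 : 1 ≤ y 0 := (Finset.mem_filter.1 hy'.1).2
      have h : ((y 0).toNat : ℤ) = y 0 := Int.toNat_of_nonneg (by omega)
      have hgy : (y 0).toNat = b := by have := hy'.2; simpa [hg] using this
      have h' : (y 0 : ℤ) = (b : ℤ) := by rw [← h, hgy]
      exact_mod_cast h'
    have hb0 : (0 : ℝ) < b := by exact_mod_cast hb1
    -- rewrite the fibre sum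
    have hre : ∑ y ∈ Yf.filter (fun y => g y = b),
          (s * (y 0 : ℝ)) ^ 3 / (1 + s * (y 0 : ℝ)) ^ 3 /
            ((a + (y 0 : ℝ)) ^ 2 * (1 + (a + (y 0 : ℝ)) + ‖c - Fin.tail y‖) ^ 6) =
        (s * b) ^ 3 / (1 + s * b) ^ 3 / (a + b) ^ 2 *
          ∑ y ∈ Yf.filter (fun y => g y = b), ((1 + (a + b) + ‖c - Fin.tail y‖) ^ 6)⁻¹ := by
      rw [Finset.mul_sum]
      refine Finset.sum_congr rfl fun y hy => ?_
      rw [hyb y hy]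
      field_simp
    -- the transverse sum through the injection `tail`
    have hinj : Set.InjOn (Fin.tail : Site 4 → Site 3) ↑(Yf.filter (fun y => g y = b)) := by
      intro y₁ hy₁ y₂ hy₂ ht
      have h1 : (y₁ 0 : ℝ) = b := hyb y₁ hy₁
      have h2 : (y₂ 0 : ℝ) = b := hyb y₂ hy₂
      have h0 : y₁ 0 = y₂ 0 := by exact_mod_cast h1.trans h2.symm
      exact eq_of_apply_zero_eq_of_tail_eq h0 ht
    have htrans : ∑ y ∈ Yf.filter (fun y => g y = b), ((1 + (a + b) + ‖c - Fin.tail y‖) ^ 6)⁻¹ ≤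
        Z / (1 + (a + b)) ^ 3 := by
      have himg := Finset.sum_image (f := fun z : Site 3 => ((1 + (a + (b : ℝ)) + ‖c - z‖) ^ 6)⁻¹) hinj
      rw [← himg]
      exact sum_inv_pow_shift_le c (by positivity) _
    rw [hre]
    have hφ0 : 0 ≤ (s * b) ^ 3 / (1 + s * b) ^ 3 / (a + b) ^ 2 := by positivity
    refine (mul_le_mul_of_nonneg_left htrans hφ0).trans ?_
    -- `(a+b)⁻² (1+a+b)⁻³ ≤ a⁻² b⁻³`
    have hab2 : a ^ 2 ≤ (a + b) ^ 2 := pow_le_pow_left₀ ha0.le (by linarith) 2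
    have hab3 : (b : ℝ) ^ 3 ≤ (1 + (a + b)) ^ 3 := pow_le_pow_left₀ hb0.le (by linarith) 3
    have key : (s * b) ^ 3 / (1 + s * b) ^ 3 / (a + b) ^ 2 * (Z / (1 + (a + b)) ^ 3) =
        (Z * s ^ 3 / (1 + s * b) ^ 3) * ((b : ℝ) ^ 3 / ((a + b) ^ 2 * (1 + (a + b)) ^ 3)) := by
      field_simp
    have hfrac : (b : ℝ) ^ 3 / ((a + b) ^ 2 * (1 + (a + b)) ^ 3) ≤ 1 / a ^ 2 := by
      rw [div_le_div_iff₀ (by positivity) (by positivity), one_mul]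
      calc (b : ℝ) ^ 3 * a ^ 2 = a ^ 2 * (b : ℝ) ^ 3 := by ring
        _ ≤ (a + b) ^ 2 * (1 + (a + b)) ^ 3 := mul_le_mul hab2 hab3 (by positivity) (by positivity)
    rw [key]
    calc (Z * s ^ 3 / (1 + s * b) ^ 3) * ((b : ℝ) ^ 3 / ((a + b) ^ 2 * (1 + (a + b)) ^ 3))
        ≤ (Z * s ^ 3 / (1 + s * b) ^ 3) * (1 / a ^ 2) := mul_le_mul_of_nonneg_left hfrac (by positivity)
      _ = Z / a ^ 2 * (s ^ 3 / (1 + s * ↑b) ^ 3) := by field_simp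
  -- sum over the time coordinates `b`
  have hB : ∀ b ∈ Yf.image g, 1 ≤ b := by
    intro b hb
    obtain ⟨y, hy, rfl⟩ := Finset.mem_image.1 hb
    have hy1 : 1 ≤ y 0 := (Finset.mem_filter.1 hy).2
    have : (1 : ℤ) ≤ ((y 0).toNat : ℤ) := by rw [Int.toNat_of_nonneg (by omega)]; exact hy1
    exact_mod_cast this
  calc ∑ b ∈ Yf.image g, ∑ y ∈ Yf.filter (fun y => g y = b),
          (s * (y 0 : ℝ)) ^ 3 / (1 + s * (y 0 : ℝ)) ^ 3 /
            ((a + (y 0 : ℝ)) ^ 2 * (1 + (a + (y 0 : ℝ)) + ‖c - Fin.tail y‖) ^ 6)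
      ≤ ∑ b ∈ Yf.image g, Z / a ^ 2 * (s ^ 3 / (1 + s * (b : ℝ)) ^ 3) := Finset.sum_le_sum hfib
    _ = Z / a ^ 2 * ∑ b ∈ Yf.image g, s ^ 3 / (1 + s * (b : ℝ)) ^ 3 := by rw [Finset.mul_sum]
    _ ≤ Z / a ^ 2 * s ^ 2 := mul_le_mul_of_nonneg_left (sum_cube_div_le hs _ hB) (by positivity)
    _ = Z * s ^ 2 / a ^ 2 := by ring

/-- **Transverse-then-time sum at positive times, exponent 7** (`a ≥ 1`, `c ∈ ℤ³` fixed):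
`Σ_{y : 1 ≤ y 0} (s b)³(1+s b)⁻³ / ((a+b) (1+a+b+‖c−y'‖)⁶) ≤ Z₃ s / a²`. [folklore] -/
theorem inner_sum_seven_le {s : ℝ} (hs : 0 < s) {a : ℝ} (ha : 1 ≤ a) (c : Site 3) (Y : Finset (Site 4)) :
    ∑ y ∈ Y.filter (fun y => 1 ≤ y 0),
        (s * (y 0 : ℝ)) ^ 3 / (1 + s * (y 0 : ℝ)) ^ 3 /
          ((a + (y 0 : ℝ)) * (1 + (a + (y 0 : ℝ)) + ‖c - Fin.tail y‖) ^ 6) ≤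
      (3 ^ 3 * ∑' k : ℕ, (((k : ℝ) + 1) ^ 2)⁻¹) * s / a ^ 2 := by
  classical
  set Z : ℝ := 3 ^ 3 * ∑' k : ℕ, (((k : ℝ) + 1) ^ 2)⁻¹ with hZ
  have hZ0 : 0 ≤ Z := riemann_const_nonneg 3
  set Yf := Y.filter (fun y => 1 ≤ y 0) with hYf
  set g : Site 4 → ℕ := fun y => (y 0).toNat with hg
  have ha0 : 0 < a := lt_of_lt_of_le one_pos ha
  rw [← Finset.sum_fiberwise_of_maps_to (g := g) (t := Yf.image g) (fun y hy => Finset.mem_image_of_mem g hy)]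
  have hB : ∀ b ∈ Yf.image g, 1 ≤ b := by
    intro b hb
    obtain ⟨y, hy, rfl⟩ := Finset.mem_image.1 hb
    have hy1 : 1 ≤ y 0 := (Finset.mem_filter.1 hy).2
    have : (1 : ℤ) ≤ ((y 0).toNat : ℤ) := by rw [Int.toNat_of_nonneg (by omega)]; exact hy1
    exact_mod_cast this
  have hfib : ∀ b ∈ Yf.image g,
      ∑ y ∈ Yf.filter (fun y => g y = b),
          (s * (y 0 : ℝ)) ^ 3 / (1 + s * (y 0 : ℝ)) ^ 3 /
            ((a + (y 0 : ℝ)) * (1 + (a + (y 0 : ℝ)) + ‖c - Fin.tail y‖) ^ 6) ≤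
        Z / a ^ 2 * (s ^ 3 * (b : ℝ) / (1 + s * (b : ℝ)) ^ 3) := by
    intro b hb
    have hb1 : 1 ≤ b := hB b hb
    have hyb : ∀ y ∈ Yf.filter (fun y => g y = b), (y 0 : ℝ) = (b : ℝ) := by
      intro y hy
      have hy' := Finset.mem_filter.1 hy
      have hy1 : 1 ≤ y 0 := (Finset.mem_filter.1 hy'.1).2
      have h : ((y 0).toNat : ℤ) = y 0 := Int.toNat_of_nonneg (by omega)
      have hgy : (y 0).toNat = b := by have := hy'.2; simpa [hg] using this
      have h' : (y 0 : ℤ) = (b : ℤ) := by rw [← h, hgy]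
      exact_mod_cast h'
    have hb0 : (0 : ℝ) < b := by exact_mod_cast hb1
    have hre : ∑ y ∈ Yf.filter (fun y => g y = b),
          (s * (y 0 : ℝ)) ^ 3 / (1 + s * (y 0 : ℝ)) ^ 3 /
            ((a + (y 0 : ℝ)) * (1 + (a + (y 0 : ℝ)) + ‖c - Fin.tail y‖) ^ 6) =
        (s * b) ^ 3 / (1 + s * b) ^ 3 / (a + b) *
          ∑ y ∈ Yf.filter (fun y => g y = b), ((1 + (a + b) + ‖c - Fin.tail y‖) ^ 6)⁻¹ := by
      rw [Finset.mul_sum]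
      refine Finset.sum_congr rfl fun y hy => ?_
      rw [hyb y hy]
      field_simp
    have hinj : Set.InjOn (Fin.tail : Site 4 → Site 3) ↑(Yf.filter (fun y => g y = b)) := by
      intro y₁ hy₁ y₂ hy₂ ht
      have h1 : (y₁ 0 : ℝ) = b := hyb y₁ hy₁
      have h2 : (y₂ 0 : ℝ) = b := hyb y₂ hy₂
      have h0 : y₁ 0 = y₂ 0 := by exact_mod_cast h1.trans h2.symm
      exact eq_of_apply_zero_eq_of_tail_eq h0 ht
    have htrans : ∑ y ∈ Yf.filter (fun y => g y = b), ((1 + (a + b) + ‖c - Fin.tail y‖) ^ 6)⁻¹ ≤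
        Z / (1 + (a + b)) ^ 3 := by
      have himg := Finset.sum_image (f := fun z : Site 3 => ((1 + (a + (b : ℝ)) + ‖c - z‖) ^ 6)⁻¹) hinj
      rw [← himg]
      exact sum_inv_pow_shift_le c (by positivity) _
    rw [hre]
    have hφ0 : 0 ≤ (s * b) ^ 3 / (1 + s * b) ^ 3 / (a + b) := by positivity
    refine (mul_le_mul_of_nonneg_left htrans hφ0).trans ?_
    -- `b² / ((a+b)(1+a+b)³) ≤ 1/a²`
    have hab1 : (a + b) ^ 4 ≤ (a + b) * (1 + (a + b)) ^ 3 := by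
      have h1 : (a + b) ^ 3 ≤ (1 + (a + b)) ^ 3 := pow_le_pow_left₀ (by positivity) (by linarith) 3
      calc (a + b) ^ 4 = (a + b) * (a + b) ^ 3 := by ring
        _ ≤ (a + b) * (1 + (a + b)) ^ 3 := mul_le_mul_of_nonneg_left h1 (by positivity)
    have hab2 : a ^ 2 * (b : ℝ) ^ 2 ≤ (a + b) ^ 4 := by
      have h1 : a * b ≤ (a + b) ^ 2 := by nlinarith [mul_pos ha0 hb0]
      calc a ^ 2 * (b : ℝ) ^ 2 = (a * b) ^ 2 := by ring
        _ ≤ ((a + b) ^ 2) ^ 2 := pow_le_pow_left₀ (by positivity) h1 2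
        _ = (a + b) ^ 4 := by ring
    have key : (s * b) ^ 3 / (1 + s * b) ^ 3 / (a + b) * (Z / (1 + (a + b)) ^ 3) =
        (Z * (s ^ 3 * b) / (1 + s * b) ^ 3) * ((b : ℝ) ^ 2 / ((a + b) * (1 + (a + b)) ^ 3)) := by
      field_simp
    have hfrac : (b : ℝ) ^ 2 / ((a + b) * (1 + (a + b)) ^ 3) ≤ 1 / a ^ 2 := by
      rw [div_le_div_iff₀ (by positivity) (by positivity), one_mul]
      calc (b : ℝ) ^ 2 * a ^ 2 = a ^ 2 * (b : ℝ) ^ 2 := by ring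
        _ ≤ (a + b) * (1 + (a + b)) ^ 3 := hab2.trans hab1
    rw [key]
    calc (Z * (s ^ 3 * b) / (1 + s * b) ^ 3) * ((b : ℝ) ^ 2 / ((a + b) * (1 + (a + b)) ^ 3))
        ≤ (Z * (s ^ 3 * b) / (1 + s * b) ^ 3) * (1 / a ^ 2) := mul_le_mul_of_nonneg_left hfrac (by positivity)
      _ = Z / a ^ 2 * (s ^ 3 * ↑b / (1 + s * ↑b) ^ 3) := by field_simp
  calc ∑ b ∈ Yf.image g, ∑ y ∈ Yf.filter (fun y => g y = b),
          (s * (y 0 : ℝ)) ^ 3 / (1 + s * (y 0 : ℝ)) ^ 3 /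
            ((a + (y 0 : ℝ)) * (1 + (a + (y 0 : ℝ)) + ‖c - Fin.tail y‖) ^ 6)
      ≤ ∑ b ∈ Yf.image g, Z / a ^ 2 * (s ^ 3 * (b : ℝ) / (1 + s * (b : ℝ)) ^ 3) := Finset.sum_le_sum hfib
    _ = Z / a ^ 2 * ∑ b ∈ Yf.image g, s ^ 3 * (b : ℝ) / (1 + s * (b : ℝ)) ^ 3 := by rw [Finset.mul_sum]
    _ ≤ Z / a ^ 2 * s := mul_le_mul_of_nonneg_left (sum_cube_mul_div_le hs _ hB) (by positivity)
    _ = Z * s / a ^ 2 := by ring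

end Slices

end Summit.QuantumFields.YangMills.Cruxes.IR.AfOnset

end
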